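import Mathlib
import Summits.CriticalPhenomena.SAWScalingLimit.Theorems.SAWDefectDecoherenceBoundaryClosureRSchwarzReflection
import Summits.CriticalPhenomena.SAWScalingLimit.Theorems.SAWDefectDecoherenceBoundaryClosureRWeightedLiouville
import Summits.CriticalPhenomena.SAWScalingLimit.Theorems.SAWDefectDecoherenceBoundaryClosureRRealLineRigidityDensity
import Summits.CriticalPhenomena.SAWScalingLimit.Theorems.SAWDefectDecoherenceBoundaryClosureRRealLineRigidityReflection
import Summits.CriticalPhenomena.SAWScalingLimit.Theorems.SAWDefectDecoherenceBoundaryClosureRRealLineRigidityCorner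
import HarnessLib

/-!
# Real-line rigidity (crux `BoundaryClosureR`, stmt-CriticalPhenomena-14004, line
# `polygon-parity-squeeze`, registered sub-goal (A2-main) `realLine_rigidity` of
# `stub_polygonIdentification`)

The abstract complex-analysis heart of mechanism (A) of the line (identification on exact
polygons): a holomorphic `K` on the upper half-plane whose distributional `∂̄` near every real
point off a finite set `X` is a ONE-PHASE positive measure `e^{iθ} ν` carried by the axis, with a
weighted area bound and a finite boundary `β`-moment at the points of `X` and the decay
`‖K‖ |w|^{-11/4} ∈ L¹` at infinity, is CONSTANT.

Proof (the gluing of four landed lemmas).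
1. `schwarzReflection_of_boundaryMeasure` + `realLine_localDensity`: near each real `t ∉ X`,
   `K` has a holomorphic extension `G` across the axis whose trace `a G` (`a = -(i/2) e^{-iθ}`)
   is a non-negative real, and `ν = re (a G) dx` there.
2. `realLine_reflection`: the global reflection `K̃` of `a K` across `ℝ ∖ X` — holomorphic off
   `X`, conjugation-symmetric, `≥ 0` on the axis, `ν = re K̃ dx` on corner-free open sets.
3. `realLine_cornerRemovable`: every `x ∈ X` is removable (pole order `≤ 2` from the weighted
   bound, order `2` killed by the `β`-moment, order `1` by parity), so `K̃` extends to an entire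
   function `E`.
4. `entire_eq_const_of_integrable_weight` (`γ = 11/4 < 3`): `‖E‖ (1 + |w|)^{-11/4} ∈ L¹(ℂ)` (a
   compact disc, plus the upper far region from the hypothesis at infinity and its reflection),
   so `E` is constant, hence so is `K = a⁻¹ E` on the upper half-plane.
-/

noncomputable section

open scoped Topology ContDiff ENNReal ComplexConjugate
open Filter Set MeasureTheory Metric Complex
open Literature.Analysis.Complex (dbarAlong)

namespace Summit.CriticalPhenomena.SAWScalingLimit.Theorems.PolygonParitySqueeze

open RealLine

/-- **Registered sub-goal `realLine_rigidity`** (mechanism (A), (A2-main), of line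
`polygon-parity-squeeze`; crux item stmt-CriticalPhenomena-14004).  A holomorphic `K` on the
upper half-plane with one-phase positive-measure boundary pairings off a finite real set `X`,
weighted integrability and a finite boundary moment at the points of `X`, and
`‖K‖ |w|^{-11/4}`-integrability at infinity, is constant (Schwarz reflection + pole order +
parity + weighted Liouville). [folklore] -/
theorem realLine_rigidity : ∀ (K : ℂ → ℂ) (X : Finset ℝ) (θ : ℝ) (ν : MeasureTheory.Measure ℝ), DifferentiableOn ℂ K {w : ℂ | 0 < w.im} → (∀ y : ℝ, y ∉ X → ∃ r : ℝ, 0 < r ∧ (∀ x ∈ X, r ≤ |y - x|) ∧ ν (Set.Ioo (y - r) (y + r)) < ⊤ ∧ MeasureTheory.IntegrableOn K (Metric.ball (y : ℂ) r ∩ {w : ℂ | 0 < w.im}) ∧ ∀ φ : ℂ → ℂ, ContDiff ℝ ∞ φ → HasCompactSupport φ → tsupport φ ⊆ Metric.ball (y : ℂ) r → ∫ w in Metric.ball (y : ℂ) r ∩ {w : ℂ | 0 < w.im}, K w * Literature.Analysis.Complex.dbarAlong 1 φ w = Complex.exp (θ * Complex.I) * ∫ x in Set.Ioo (y - r) (y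 + r), φ (x : ℂ) ∂ν) → (∀ x ∈ X, ∃ (r γ β : ℝ), 0 < r ∧ 0 ≤ γ ∧ γ < 1 ∧ 0 ≤ β ∧ β < 1 ∧ MeasureTheory.IntegrableOn (fun w : ℂ => (‖w - (x : ℂ)‖ ^ γ : ℝ) * ‖K w‖) (Metric.ball (x : ℂ) r ∩ {w : ℂ | 0 < w.im}) ∧ ∫⁻ t in Set.Ioo (x - r) (x + r), ENNReal.ofReal (|t - x| ^ β) ∂ν < ⊤) → (∃ R : ℝ, MeasureTheory.IntegrableOn (fun w => ‖K w‖ * ‖w‖ ^ (-(11 / 4 : ℝ))) ({w : ℂ | 0 < w.im} ∩ {w : ℂ | R < ‖w‖})) → ∃ c : ℂ, ∀ w : ℂ, 0 < w.im → K w = c := by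
  intro K X θ ν hK hpair hcorner hinf
  classical
  -- the phase and the density constant `a = -(i/2) e⁻¹`
  set e : ℂ := Complex.exp (θ * I) with he
  have he0 : e ≠ 0 := exp_ne_zero _
  set a : ℂ := -(I / 2) * e⁻¹ with ha
  have ha0 : a ≠ 0 :=
    mul_ne_zero (neg_ne_zero.2 (div_ne_zero I_ne_zero two_ne_zero)) (inv_ne_zero he0)
  ---------------------------------------------------------------- step 1: local extensions
  have hloc : ∀ t : ℝ, t ∉ X → ∃ r : ℝ, 0 < r ∧ (∀ x ∈ X, r ≤ |t - x|) ∧ ∃ G : ℂ → ℂ,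
      DifferentiableOn ℂ G (ball (t : ℂ) r) ∧ EqOn G K (ball (t : ℂ) r ∩ {w : ℂ | 0 < w.im}) ∧
      (∀ s ∈ Ioo (t - r) (t + r), (a * G s).im = 0 ∧ 0 ≤ (a * G s).re) ∧
      ν.restrict (Ioo (t - r / 2) (t + r / 2)) = (volume.withDensity fun s : ℝ =>
        ENNReal.ofReal (a * G s).re).restrict (Ioo (t - r / 2) (t + r / 2)) := by
    intro t ht
    obtain ⟨r, hr, hfar, hν, hKi, hp⟩ := hpair t ht
    haveI : IsFiniteMeasure (ν.restrict (Ioo (t - r) (t + r))) := isFiniteMeasure_restrict.2 hν.ne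
    obtain ⟨G, hGd, hGK⟩ := schwarzReflection_of_boundaryMeasure K t r hr
      (hK.mono inter_subset_right) hKi ⟨ν.restrict (Ioo (t - r) (t + r)), θ, inferInstance, hp⟩
    have hpG : ∀ φ : ℂ → ℂ, ContDiff ℝ ∞ φ → HasCompactSupport φ → tsupport φ ⊆ ball (t : ℂ) r →
        ∫ w in ball (t : ℂ) r ∩ {w : ℂ | 0 < w.im}, G w * dbarAlong 1 φ w =
          e * ∫ x in Ioo (t - r) (t + r), φ x ∂ν := by
      intro φ hφ hφc hφs
      rw [← hp φ hφ hφc hφs]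
      exact setIntegral_congr_fun
        (measurableSet_ball.inter (isOpen_lt continuous_const continuous_im).measurableSet)
        fun w hw => by rw [hGK hw]
    obtain ⟨hpos, hdens⟩ := realLine_localDensity G t r e ν hr he0 hGd hν hpG
    exact ⟨r, hr, hfar, G, hGd, hGK, hpos, hdens⟩
  ---------------------------------------------------------------- step 2: global reflection
  obtain ⟨Kt, hKtd, hKt_up, hKt_conj, hKt_pos, hKt_dens⟩ := realLine_reflection K X a ν hK hloc
  set U : Set ℂ := ((fun x : ℝ => (x : ℂ)) '' (X : Set ℝ))ᶜ with hU
  have hUo : IsOpen U := (X.finite_toSet.image _).isClosed.isOpen_compl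
  have hU_im : ∀ z : ℂ, z.im ≠ 0 → z ∈ U := by
    rintro z hz ⟨x, -, rfl⟩
    exact hz (ofReal_im x)
  ---------------------------------------------------------------- step 3: corners, extension
  have hrem : ∀ x : ℝ, ∃ ρ : ℝ, ∃ M : ℂ → ℂ, x ∈ X →
      (0 < ρ ∧ DifferentiableOn ℂ M (ball (x : ℂ) ρ) ∧ EqOn M Kt (ball (x : ℂ) ρ \ {(x : ℂ)})) := by
    intro x
    by_cases hx : x ∈ X
    · obtain ⟨r₀, γ, β, hr₀, hγ0, hγ1, -, hβ1, hint, hmom⟩ := hcorner x hx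
      have hint' : IntegrableOn (fun w : ℂ => (‖w - (x : ℂ)‖ ^ γ : ℝ) * ‖Kt w‖)
          (ball (x : ℂ) r₀ ∩ {w : ℂ | 0 < w.im}) := by
        refine IntegrableOn.congr_fun (hint.const_mul ‖a‖) (fun w hw => ?_)
          (measurableSet_ball.inter (isOpen_lt continuous_const continuous_im).measurableSet)
        show ‖a‖ * (‖w - (x : ℂ)‖ ^ γ * ‖K w‖) = ‖w - (x : ℂ)‖ ^ γ * ‖Kt w‖
        rw [hKt_up w hw.2, norm_mul a (K w)]
        ring
      obtain ⟨ρ, hρ, M, hM, hMeq⟩ := realLine_cornerRemovable Kt X ν x r₀ γ β hx hKtd hKt_conj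
        hKt_pos hKt_dens hr₀ hγ0 hγ1 hβ1 hint' hmom
      exact ⟨ρ, M, fun _ => ⟨hρ, hM, hMeq⟩⟩
    · exact ⟨1, 0, fun h => absurd h hx⟩
  choose ρ M hρM using hrem
  set E : ℂ → ℂ := fun w => if w.im = 0 ∧ w.re ∈ X then M w.re w else Kt w with hE
  have hEU : ∀ w ∈ U, E w = Kt w := by
    intro w hw
    simp only [hE]
    rw [if_neg]
    rintro ⟨h0, hre⟩
    exact hw ⟨w.re, hre, Complex.ext (by simp) (by simp [h0])⟩
  have hEd : Differentiable ℂ E := by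
    intro w
    by_cases hw : w ∈ U
    · have hev : E =ᶠ[𝓝 w] Kt := by
        filter_upwards [hUo.mem_nhds hw] with z hz
        exact hEU z hz
      exact hev.differentiableAt_iff.2 (hKtd.differentiableAt (hUo.mem_nhds hw))
    · obtain ⟨x, hx, rfl⟩ : w ∈ (fun x : ℝ => (x : ℂ)) '' (X : Set ℝ) := not_notMem.1 hw
      obtain ⟨hρ, hMd, hMeq⟩ := hρM x hx
      obtain ⟨r₁, hr₁, hr₁U⟩ := exists_ball_diff_subset X x
      have hev : E =ᶠ[𝓝 (x : ℂ)] M x := by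
        filter_upwards [ball_mem_nhds (x : ℂ) (lt_min hρ hr₁)] with z hz
        by_cases hzx : z = x
        · subst hzx
          simp only [hE, ofReal_im, ofReal_re, true_and]
          rw [if_pos (Finset.mem_coe.1 hx)]
        · have hzU : z ∈ U := hr₁U ⟨ball_subset_ball (min_le_right _ _) hz, hzx⟩
          rw [hEU z hzU, hMeq ⟨ball_subset_ball (min_le_left _ _) hz, hzx⟩]
      exact hev.differentiableAt_iff.2 (hMd.differentiableAt (ball_mem_nhds _ hρ))
  ---------------------------------------------------------------- step 4: Liouville
  obtain ⟨R, hR⟩ := hinf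
  set R₁ : ℝ := max R 1 with hR₁
  set Φ : ℂ → ℝ := fun w => ‖E w‖ * (1 + ‖w‖) ^ (-(11 / 4 : ℝ)) with hΦ
  have hΦc : Continuous Φ :=
    hEd.continuous.norm.mul ((continuous_const.add continuous_norm).rpow_const
      fun w => Or.inl (add_pos_of_pos_of_nonneg one_pos (norm_nonneg w)).ne')
  have hΦint : Integrable Φ := by
    rw [← integrableOn_univ, ← union_compl_self (closedBall (0 : ℂ) R₁)]
    refine IntegrableOn.union (hΦc.continuousOn.integrableOn_compact (isCompact_closedBall _ _)) ?_
    have hset : (closedBall (0 : ℂ) R₁)ᶜ = {w : ℂ | R₁ < ‖w‖} := by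
      ext w
      simp [not_le]
    rw [hset]
    have hopen : IsOpen {w : ℂ | R₁ < ‖w‖} := isOpen_lt continuous_const continuous_norm
    refine integrableOn_of_upper_half hopen.measurableSet (fun z hz => ?_) (fun z _ hz => ?_) ?_
    · show R₁ < ‖conj z‖
      rw [norm_conj]
      exact hz
    · have hcz : (conj z).im ≠ 0 := by rw [conj_im]; exact neg_ne_zero.2 hz.ne'
      show ‖E (conj z)‖ * (1 + ‖conj z‖) ^ (-(11 / 4 : ℝ)) = ‖E z‖ * (1 + ‖z‖) ^ (-(11 / 4 : ℝ))
      rw [norm_conj, hEU _ (hU_im _ hcz), hEU _ (hU_im z hz.ne'), hKt_conj z hz.ne', norm_conj]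
    · have hmeas : MeasurableSet ({w : ℂ | R₁ < ‖w‖} ∩ {z : ℂ | 0 < z.im}) :=
        hopen.measurableSet.inter (isOpen_lt continuous_const continuous_im).measurableSet
      have h1 : IntegrableOn (fun w => ‖K w‖ * ‖w‖ ^ (-(11 / 4 : ℝ)))
          ({w : ℂ | R₁ < ‖w‖} ∩ {z : ℂ | 0 < z.im}) :=
        hR.mono_set fun w hw => ⟨hw.2, (lt_of_le_of_lt (le_max_left R 1) hw.1 : R < ‖w‖)⟩
      refine Integrable.mono' (h1.const_mul ‖a‖) hΦc.aestronglyMeasurable.restrict ?_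
      refine (ae_restrict_iff' hmeas).2 (Eventually.of_forall fun w hw => ?_)
      rw [Real.norm_of_nonneg (by positivity)]
      show ‖E w‖ * (1 + ‖w‖) ^ (-(11 / 4 : ℝ)) ≤ ‖a‖ * (‖K w‖ * ‖w‖ ^ (-(11 / 4 : ℝ)))
      rw [hEU w (hU_im w hw.2.ne'), hKt_up w hw.2, norm_mul, mul_assoc]
      refine mul_le_mul_of_nonneg_left (mul_le_mul_of_nonneg_left ?_ (norm_nonneg _))
        (norm_nonneg _)
      have hw0 : 0 < ‖w‖ := lt_of_le_of_lt (by positivity) (lt_of_le_of_lt (le_max_right R 1) hw.1)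
      exact Real.rpow_le_rpow_of_nonpos hw0 (by linarith) (by norm_num)
  have hconst := Analysis.entire_eq_const_of_integrable_weight E (11 / 4) hEd (by norm_num) hΦint
  refine ⟨a⁻¹ * E 0, fun w hw => ?_⟩
  rw [← hconst w, hEU w (hU_im w hw.ne'), hKt_up w hw, ← mul_assoc, inv_mul_cancel₀ ha0, one_mul]

end Summit.CriticalPhenomena.SAWScalingLimit.Theorems.PolygonParitySqueeze

end
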